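import Summits.Ventures.KdS.RouteWNonExtremeStrata
import Summits.Ventures.KdS.RouteWRealAxisNoRay
import Summits.Ventures.KdS.RouteWSchwarzschildDeSitter
import Literature.Geometry.Lorentzian.KerrDeSitterRealFrequencyModes
import HarnessLib

/-!
# Venture KdS — Theorem 3.10 for EVERY spin with NO threshold-ray exception: growing modes are
# superradiant (`a > 0`), and Schwarzschild–de Sitter (`a = 0`) is mode stable for every spin

HONEST FRAMING (venture `Summits/Ventures/KdS`, cell `pub-kds`; optional kernel object of the
Monday S3 seat; corollaries of `RouteWNonExtremeStrata.prop38_without_p₁` (P1 g13),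
`RouteWRealAxisNoRay.realAxis_vanishing_noRay` (P1 g13), `RouteWRealAxisHighSpin.pairCondition_p3`
(LIT-1 g23) and `RouteWSchwarzschildDeSitter` (P1 g13, the `a = 0` angular input)). The
tree's all-spin form of CTdC Thm 3.10 bullet 1 (`RouteW.theorem310_bullet1`, `window_allSpins`; the
Literature `…theorem310[.window]`, `…partialModeStability.window_of_hasMode`) carries the printed
GENERIC-REGIME disjunction `Re ω ≠ mϖ₁ ∨ s ≤ 0` ("only that bounded window (and the threshold rays)
is left to a certificate"). With `NonExtremeStrata` proved the event threshold ray needs no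
exception and Prop. 3.8's pair conditions are all discharged:
* `radial_vanishing_upperHalfPlane` — for EVERY `s ∈ ½ℤ`, subextremal `(M,a,Λ)` with `0 ≤ a`,
  `Im ω > 0`, `Im(λ̄ω̄) ≤ 0`, `|ω| ∉ |m|·(0, Ω_SR)`: every classical radial Teukolsky solution on
  `(r₊, r_c)` ingoing at `𝓗⁺` / outgoing at `𝓗⁺_c` IN THE SENSE OF THE TREE'S GENERIC-BULLET
  PREDICATES vanishes; `window_upperHalfPlane`; `theorem310_noRegime` = `theorem310_window`'s
  binder list (window clause for every spin) with BOTH regime disjunctions removed;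
* ★ `hasMode_window` — `a > 0`, `m − s ∈ ℤ`: every Teukolsky MODE (`HasMode`, Def. 3.4 as typed)
  with `Im ω > 0` lies in the superradiant window `0 < |ω| < |m|·Ω_SR` (the tree's PROVED angular
  sign lemma); `not_hasMode_axisymmetric` (no growing `m = 0` mode, any integer spin);
  `noModeIn_offWindow`; ★★ `hasMode_superradiant` — the CLOSED upper half-plane: every mode with
  `Im ω ≥ 0`, `ω ≠ 0` is superradiant (`Im ω > 0`: `0 < |ω| < |m|Ω_SR`; `Im ω = 0`: `m ≠ 0`,
  `ω/m ∈ (Ω_low, Ω_SR)`, by `realAxis_vanishing_noRay` + the tree's `angularEigenvalue_real`) —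
  CTdC Thm 3.10 for modes with the window clause for every spin and no regime disjunction;
  `noModeIn_closed_offWindows`;
* ★★ `modeStable_zero_a_allSpins` — `a = 0`: `ModeStable M 0 Λ s` for EVERY subextremal
  Schwarzschild–de Sitter `(M, 0, Λ)` and EVERY `s ∈ ½ℤ` (no mode with `Im ω ≥ 0`, `ω ≠ 0`),
  completing `RouteWSchwarzschildDeSitter.modeStable_zero_a_of_lt_one` (`s < 1`; angular input
  `angularSign_zero_a`, empty windows, real axis for every spin): for `s ≥ 1` and `Im ω > 0` the
  event ray `Re ω = m·0` is the whole imaginary axis — exactly where the old disjunction bit and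
  `NonExtremeStrata` is needed (`not_hasMode_zero_a` via `radial_vanishing_upperHalfPlane`). The
  tree had `a = 0` mode stability for `s = 0` only (`modeStable_zero_a`, master scalar equation);
  `modeStable[On]_schwarzschildDeSitter_allSpins` over `0 < 9ΛM² < 1`.
Caveat as in `RouteWNonExtremeStrata` (REFEREE #451 (8)): "ingoing/outgoing" are the generic-bullet
predicates `IsIngoingAtEventHorizon` / `IsOutgoingAtCosmoHorizon` (Def. 3.3 AS TYPED, cofactor
allowed to vanish); nothing here is a statement about the superradiant window itself for `a > 0`,
nonlinear stability or the Final State Conjecture. 0 cited facts, no `sorry`.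
-/

noncomputable section

open Set Complex

namespace Summit.Ventures.KdS

namespace RouteW

open Literature.Geometry.Lorentzian Literature.Geometry.Lorentzian.KerrDeSitter

/-- ★ **Thm 3.10 bullet 1 for every spin, no threshold-ray disjunction, no pair condition.**
Subextremal `(M,a,Λ)`, `0 ≤ a`, `2s ∈ ℤ`, `Im ω > 0`, `Im(λ̄ω̄) ≤ 0`, `|ω| ∉ |m|(0,Ω_SR)` ⟹ every
generic-bullet radial Teukolsky solution vanishes on `(r₊, r_c)` (`prop38_without_p₁` with
`p₃ = pairCondition_p3`). PROVED, 0 cited facts. -/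
theorem radial_vanishing_upperHalfPlane {M a Λ s : ℝ} {ω : ℂ} {m : ℝ} {lam : ℂ} {R : ℝ → ℂ}
    (hsub : IsSubextremal M a Λ) (ha : 0 ≤ a) (h2s : ∃ k : ℤ, 2 * s = k) (hω : 0 < ω.im)
    (hlam : (lambdaBar a Λ s ω m lam * (starRingEnd ℂ) ω).im ≤ 0)
    (hSR : ¬(0 < ‖ω‖ ∧ ‖ω‖ < |m| * superradiantUpper M a Λ))
    (hR : IsRadialTeukolskySolution M a Λ s ω m lam R) (hin : IsIngoingAtEventHorizon M a Λ s ω m R)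
    (hout : IsOutgoingAtCosmoHorizon M a Λ ω m R) :
    ∀ r ∈ Ioo (rPlus M a Λ) (rCosmo M a Λ), R r = 0 :=
  prop38_without_p₁ M a Λ s ω m lam hsub ha h2s hω hlam hSR (pairCondition_p3 hsub ha hω.le m) R hR
    hin hout

/-- **Window form.** A non-trivial generic-bullet radial solution with `Im ω > 0` and
`Im(λ̄ω̄) ≤ 0` has `0 < |ω| < |m|·Ω_SR`, for every `s ∈ ½ℤ` (no generic-regime disjunction). -/
theorem window_upperHalfPlane {M a Λ s : ℝ} {ω : ℂ} {m : ℝ} {lam : ℂ} {R : ℝ → ℂ}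
    (hsub : IsSubextremal M a Λ) (ha : 0 ≤ a) (h2s : ∃ k : ℤ, 2 * s = k) (hω : 0 < ω.im)
    (hlam : (lambdaBar a Λ s ω m lam * (starRingEnd ℂ) ω).im ≤ 0)
    (hR : IsRadialTeukolskySolution M a Λ s ω m lam R) (hin : IsIngoingAtEventHorizon M a Λ s ω m R)
    (hout : IsOutgoingAtCosmoHorizon M a Λ ω m R)
    (hnt : ∃ r ∈ Ioo (rPlus M a Λ) (rCosmo M a Λ), R r ≠ 0) :
    0 < ‖ω‖ ∧ ‖ω‖ < |m| * superradiantUpper M a Λ := by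
  by_contra hw
  obtain ⟨r, hr, hne⟩ := hnt
  exact hne (radial_vanishing_upperHalfPlane hsub ha h2s hω hlam hw hR hin hout r hr)

/-- ★ **Growing modes are superradiant, for every spin** (CTdC Thm 3.10 bullet 1 + Lemma 3.1 for
MODE solutions, Def. 3.4 as typed, with no threshold-ray exception): on subextremal Kerr–de Sitter
with `a > 0`, for `2s ∈ ℤ` and admissible `m` (`m − s ∈ ℤ`), every mode with `Im ω > 0` has
`0 < |ω| < |m|·Ω_SR` (the angular sign lemma `CasalsTeixeiraDaCosta2022_angularSign_holds` gives
`Im(λ̄ω̄) < 0`). PROVED, 0 cited facts. -/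
theorem hasMode_window {M a Λ s : ℝ} {ω : ℂ} {m : ℝ} (hsub : IsSubextremal M a Λ) (ha : 0 < a)
    (h2s : ∃ k : ℤ, 2 * s = k) (hm : ∃ k : ℤ, m - s = k) (hω : 0 < ω.im)
    (hmode : HasMode M a Λ s ω m) : 0 < ‖ω‖ ∧ ‖ω‖ < |m| * superradiantUpper M a Λ := by
  obtain ⟨lam, R, hang, hR, hin, hout, hnt⟩ := hmode
  have hsign := CasalsTeixeiraDaCosta2022_angularSign_holds a Λ s ω m lam hsub.2.1 ha h2s hm hω hang
  exact window_upperHalfPlane hsub ha.le h2s hω hsign.le hR hin hout hnt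

/-- **No growing axisymmetric mode, any integer spin**: `a > 0`, `s ∈ ℤ`, `m = 0`, `Im ω > 0` ⟹
`¬HasMode` (the window `|ω| < 0·Ω_SR` is empty; the purely-imaginary frequencies `ω = iy` on the
event threshold ray `Re ω = 0·ϖ₁` are exactly where `NonExtremeStrata` was needed). -/
theorem not_hasMode_axisymmetric {M a Λ s : ℝ} {ω : ℂ} (hsub : IsSubextremal M a Λ) (ha : 0 < a)
    (hs : ∃ k : ℤ, s = k) (hω : 0 < ω.im) : ¬HasMode M a Λ s ω 0 := by
  intro hmode
  obtain ⟨k, hk⟩ := hs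
  have h := hasMode_window hsub ha ⟨2 * k, by rw [hk]; push_cast; ring⟩ ⟨-k, by rw [hk]; simp⟩ hω
    hmode
  have h2 : ‖ω‖ < 0 := by simpa using h.2
  exact absurd h2 (not_lt.mpr (norm_nonneg ω))

/-- **The same as a `NoModeIn` window**: for `a > 0` and `2s ∈ ℤ`, no mode (admissible `m`) in
`{(ω, m) : Im ω > 0, |ω| ∉ |m|·(0, Ω_SR)}` — the open upper half-plane outside the superradiant
window, threshold rays INCLUDED. -/
theorem noModeIn_offWindow {M a Λ s : ℝ} (hsub : IsSubextremal M a Λ) (ha : 0 < a)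
    (h2s : ∃ k : ℤ, 2 * s = k) :
    NoModeIn M a Λ s
      {p | 0 < p.1.im ∧ ¬(0 < ‖p.1‖ ∧ ‖p.1‖ < |p.2| * superradiantUpper M a Λ)} := by
  intro ω m hW hm hmode
  exact hW.2 (hasMode_window hsub ha h2s hm hW.1 hmode)

/-- **CTdC Theorem 3.10 (with Def. 3.4's `ω ≠ 0`) for every `s ∈ ½ℤ`, window clause for every
spin, NO generic-regime disjunction — PROVED, 0 cited facts.** `theorem310_window`'s statement
(LIT-1 g23) with the binders `h1 : Re ω ≠ mϖ₁ ∨ s ≤ 0`, `h2 : Re ω ≠ mϖ_c ∨ 0 ≤ s` (and the unused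
`|a| < 3/Λ`, `a² < 3/Λ`, `m − s ∈ ℤ`) removed: open half-plane by `radial_vanishing_upperHalfPlane`,
real axis by `realAxis_vanishing_noRay`. The omitted printed clause is still exactly the fermionic
superradiant window (`RouteWFermionicRealAxis`). -/
theorem theorem310_noRegime (M a Λ s : ℝ) (ω : ℂ) (m : ℝ) (lam : ℂ) (hsub : IsSubextremal M a Λ)
    (ha : 0 ≤ a) (h2s : ∃ k : ℤ, 2 * s = k) (hω0 : ω ≠ 0)
    (hb : (0 < ω.im ∧ (lambdaBar a Λ s ω m lam * (starRingEnd ℂ) ω).im ≤ 0 ∧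
        ¬(0 < ‖ω‖ ∧ ‖ω‖ < |m| * superradiantUpper M a Λ)) ∨
      (ω.im = 0 ∧ (lambdaBar a Λ s ω m lam).im = 0 ∧
        (m = 0 ∨ ¬(superradiantLower M a Λ < ω.re / m ∧ ω.re / m < superradiantUpper M a Λ))))
    (R : ℝ → ℂ) (hR : IsRadialTeukolskySolution M a Λ s ω m lam R)
    (hin : IsIngoingAtEventHorizon M a Λ s ω m R) (hout : IsOutgoingAtCosmoHorizon M a Λ ω m R) :
    ∀ r ∈ Ioo (rPlus M a Λ) (rCosmo M a Λ), R r = 0 := by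
  rcases hb with ⟨hω, hlam, hSR⟩ | ⟨hω, hlam, hthird⟩
  · exact radial_vanishing_upperHalfPlane hsub ha h2s hω hlam hSR hR hin hout
  · exact realAxis_vanishing_noRay hsub ha h2s hω hω0 hlam hthird hR hin hout

/-! ### The closed upper half-plane: every mode is superradiant (`a > 0`, every spin) -/

/-- ★★ **CTdC Theorem 3.10 for MODES, every spin, window clause for every spin, no regime
disjunction: on subextremal Kerr–de Sitter with `a > 0` every Teukolsky mode (Def. 3.4 as typed,
`m − s ∈ ℤ`) with `Im ω ≥ 0`, `ω ≠ 0` is SUPERRADIANT** — either `Im ω > 0` and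
`0 < |ω| < |m|·Ω_SR` (`hasMode_window`), or `ω` is real, `m ≠ 0` and `ω/m ∈ (Ω_low, Ω_SR)`
(`realAxis_vanishing_noRay` with `λ̄ ∈ ℝ` from the tree's `angularEigenvalue_real`). What is left to
certificates / to the fermionic-window analysis is exactly these two windows. PROVED, 0 facts. -/
theorem hasMode_superradiant {M a Λ s : ℝ} {ω : ℂ} {m : ℝ} (hsub : IsSubextremal M a Λ)
    (ha : 0 < a) (h2s : ∃ k : ℤ, 2 * s = k) (hm : ∃ k : ℤ, m - s = k) (hω : 0 ≤ ω.im)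
    (hω0 : ω ≠ 0) (hmode : HasMode M a Λ s ω m) :
    (0 < ω.im ∧ 0 < ‖ω‖ ∧ ‖ω‖ < |m| * superradiantUpper M a Λ) ∨
      (ω.im = 0 ∧ m ≠ 0 ∧ superradiantLower M a Λ < ω.re / m ∧
        ω.re / m < superradiantUpper M a Λ) := by
  rcases hω.lt_or_eq with hlt | heq
  · exact Or.inl ⟨hlt, hasMode_window hsub ha h2s hm hlt hmode⟩
  · refine Or.inr ⟨heq.symm, ?_⟩
    obtain ⟨lam, R, hang, hR, hin, hout, r, hr, hne⟩ := hmode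
    have hl := angularEigenvalue_real hsub.2.1.le heq.symm hang
    have hlam : (lambdaBar a Λ s ω m lam).im = 0 := by
      simp [lambdaBar, sq, Complex.mul_im, Complex.mul_re, heq.symm, hl]
    by_contra hw
    have hthird : m = 0 ∨
        ¬(superradiantLower M a Λ < ω.re / m ∧ ω.re / m < superradiantUpper M a Λ) := by
      by_cases hm0 : m = 0
      · exact Or.inl hm0
      · exact Or.inr fun h => hw ⟨hm0, h⟩
    exact hne (realAxis_vanishing_noRay hsub ha.le h2s heq.symm hω0 hlam hthird hR hin hout r hr)

/-- **`NoModeIn` form on the closed upper half-plane**: for `a > 0` and `2s ∈ ℤ`, no mode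
(admissible `m`) in `{Im ω ≥ 0, ω ≠ 0}` outside the two superradiant windows — CTdC Def. 3.4's
`unstableWindow` minus the windows, threshold rays INCLUDED, every spin. -/
theorem noModeIn_closed_offWindows {M a Λ s : ℝ} (hsub : IsSubextremal M a Λ) (ha : 0 < a)
    (h2s : ∃ k : ℤ, 2 * s = k) :
    NoModeIn M a Λ s
      {p | 0 ≤ p.1.im ∧ p.1 ≠ 0 ∧
        ¬(0 < p.1.im ∧ 0 < ‖p.1‖ ∧ ‖p.1‖ < |p.2| * superradiantUpper M a Λ) ∧
        ¬(p.1.im = 0 ∧ p.2 ≠ 0 ∧ superradiantLower M a Λ < p.1.re / p.2 ∧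
          p.1.re / p.2 < superradiantUpper M a Λ)} := by
  intro ω m hW hm hmode
  rcases hasMode_superradiant hsub ha h2s hm hW.1 hW.2.1 hmode with h | h
  · exact hW.2.2.1 h
  · exact hW.2.2.2 h

/-! ### `a = 0`: Schwarzschild–de Sitter is mode stable for every half-integer spin -/

/-- **No growing Teukolsky mode on Schwarzschild–de Sitter, ANY half-integer spin** (`a = 0`,
`Im ω > 0`, any real `m`): `Im(λ̄ω̄) ≤ 0` by `angularSign_zero_a`, the window `|ω| < |m|·0` is
empty, and `radial_vanishing_upperHalfPlane` (no threshold-ray disjunction — at `a = 0` the event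
ray `Re ω = m·0` is the whole imaginary axis, for every `m`; `s < 1` is
`not_hasMode_zero_a_of_lt_one`). PROVED, 0 cited facts. -/
theorem not_hasMode_zero_a {M Λ s : ℝ} {ω : ℂ} {m : ℝ} (hsub : IsSubextremal M 0 Λ)
    (h2s : ∃ k : ℤ, 2 * s = k) (hω : 0 < ω.im) : ¬HasMode M 0 Λ s ω m := by
  rintro ⟨lam, R, hang, hR, hin, hout, hnt⟩
  obtain ⟨r, hr, hne⟩ := hnt
  exact hne (radial_vanishing_upperHalfPlane hsub le_rfl h2s hω
    (im_lambdaBar_mul_conj_nonpos_zero_a hang hω) (not_window_zero_a M Λ ω m) hR hin hout r hr)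

/-- ★★ **Mode stability of Schwarzschild–de Sitter for the Teukolsky equation of EVERY
half-integer spin** (`ModeStable M 0 Λ s`: no mode with `Im ω ≥ 0`, `ω ≠ 0`, CTdC Def. 3.4 as
typed, generic-bullet boundary behaviour): for every subextremal `(M, 0, Λ)` and every `s ∈ ½ℤ`.
(Landed special cases: `s = 0`, `modeStable_zero_a`, master scalar equation; `s < 1`,
`RouteWSchwarzschildDeSitter.modeStable_zero_a_of_lt_one`, route W.) Here every spin, from route W,
the Teukolsky–Starobinsky flip and `NonExtremeStrata` — no Regge–Wheeler/Kodama–Ishibashi master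
equations. PROVED, 0 cited facts. -/
theorem modeStable_zero_a_allSpins {M Λ s : ℝ} (hsub : IsSubextremal M 0 Λ)
    (h2s : ∃ k : ℤ, 2 * s = k) : ModeStable M 0 Λ s := by
  intro ω m hW _ hmode
  rcases (hW.1 : 0 ≤ ω.im).lt_or_eq with hlt | heq
  · exact not_hasMode_zero_a hsub h2s hlt hmode
  · exact not_hasMode_zero_a_real hsub h2s heq.symm hW.2 hmode

/-- The same over the printed range: every Schwarzschild–de Sitter black hole (`M > 0`, `Λ > 0`,
`9ΛM² < 1`) is mode stable for the spin-`s` Teukolsky equation, every `s ∈ ½ℤ`. -/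
theorem modeStable_schwarzschildDeSitter_allSpins {M Λ s : ℝ} (hM : 0 < M) (hΛ : 0 < Λ)
    (h9 : 9 * Λ * M ^ 2 < 1) (h2s : ∃ k : ℤ, 2 * s = k) : ModeStable M 0 Λ s :=
  modeStable_zero_a_allSpins (isSubextremal_zero_a_iff.2 ⟨hM, hΛ, h9⟩) h2s

/-- Box form: spin-`s` mode stability on the Schwarzschild–de Sitter family
`{(M, 0, Λ) : M > 0, Λ > 0, 9ΛM² < 1}` (`ModeStableOn`), every `s ∈ ½ℤ`. -/
theorem modeStableOn_schwarzschildDeSitter_allSpins {s : ℝ} (h2s : ∃ k : ℤ, 2 * s = k) :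
    ModeStableOn {p : ℝ × ℝ × ℝ | 0 < p.1 ∧ p.2.1 = 0 ∧ 0 < p.2.2 ∧ 9 * p.2.2 * p.1 ^ 2 < 1} s := by
  rintro ⟨M, a, Λ⟩ ⟨hM, ha, hΛ, h9⟩
  dsimp only at hM ha hΛ h9 ⊢
  subst ha
  exact modeStable_schwarzschildDeSitter_allSpins hM hΛ h9 h2s

end RouteW

end Summit.Ventures.KdS
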